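import Mathlib
import Summits.Ventures.PercRepro2.TwoHullMasterBlocks
import Summits.Ventures.PercRepro2.TwoHullMasterGlue

/-!
# Cube covers across a cut vertex at `l` or at `h` (blind cell PercRepro2, night-4 g40,
2026-08-29; proofs/NIGHT4-G40.md §11)

A graph glued to `G₁` at the mark `l` (`Glue.IsGluing ends₁ ends₂ l V₁ V₂`, `h` on the first side)
adds FREE COORDINATES to every cube block of `G₁`: every edge of the second side is a coordinate of
its own — red is «up» — since the hull pair of `l` of the glued graph is the union of the side pairs
(`hullPair_glue_l`), monotone in the second side, and the hull pair of `h` is the first side's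
(`hullPair_glue_h`).  The antipode passes through: the colour swap of the second side swaps its
pair of `l`.  **`cubeCover_glue_l`**; and **`cubeCover_glue_h`** for a graph glued at `h` (blue is
«up» on the new coordinates).  With `cubeCover_glue2` (TwoHullMasterBlocksGlue2.lean) these are the
closure theorems of the cube-cover conjecture under the lane's gluings.
-/

namespace Summit.Ventures.PercRepro2

namespace Blocks

open Hull LocRows Path2 Glue Glue2

open scoped Classical

variable {V : Type*} {E₁ E₂ : Type*} {ends₁ : E₁ → Sym2 V} {ends₂ : E₂ → Sym2 V} {l h : V}
  {V₁ V₂ : Set V} {β : Type*} {ι : β → Type*} {pt₁ : ∀ b, (ι b → Bool) → Config E₁}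

/-- The hull pair of a vertex is monotone in the configuration. -/
lemma hullPair_mono {E : Type*} {ends : E → Sym2 V} {ζ ζ' : Config E} (hζ : ζ ≤ ζ') (x : V) :
    PairLE (hullPair ends ζ x) (hullPair ends ζ' x) := by
  refine ⟨cluster_mono hζ x, cluster_mono ?_ x⟩
  intro e
  have := hζ e
  simp only [blue]
  revert this
  cases ζ e <;> cases ζ' e <;> simp

/-- The blocks of a graph glued at `l`: the first side's block, every edge of the second side a
coordinate (red = `true`). -/
def pendPtL (pt₁ : ∀ b, (ι b → Bool) → Config E₁) (b : β) (ε : ι b ⊕ E₂ → Bool) :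
    Config (E₁ ⊕ E₂) :=
  pair (pt₁ b (ε ∘ Sum.inl)) (ε ∘ Sum.inr)

/-- The blocks of a graph glued at `h`: the first side's block, every edge of the second side a
coordinate (blue = `true`). -/
def pendPtH (pt₁ : ∀ b, (ι b → Bool) → Config E₁) (b : β) (ε : ι b ⊕ E₂ → Bool) :
    Config (E₁ ⊕ E₂) :=
  pair (pt₁ b (ε ∘ Sum.inl)) (blue (ε ∘ Sum.inr))

/-- The antipode of the sum cube restricts to the antipodes. -/
lemma cubeNot_comp_inl' {ι₁ ι₂ : Type*} (ε : ι₁ ⊕ ι₂ → Bool) :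
    cubeNot ε ∘ Sum.inl = cubeNot (ε ∘ Sum.inl) := rfl

/-- The antipode on the second summand is the colour swap. -/
lemma cubeNot_comp_inr' {ι₁ : Type*} (ε : ι₁ ⊕ E₂ → Bool) :
    (cubeNot ε ∘ Sum.inr : Config E₂) = blue (ε ∘ Sum.inr) := rfl

/-- **Cube covers survive a graph glued at `l`.** -/
theorem cubeCover_glue_l (hg : IsGluing ends₁ ends₂ l V₁ V₂) (hh : h ∈ V₁) (hhl : h ≠ l)
    (hc : CubeCover ends₁ l h pt₁) :
    CubeCover (Glue.glue ends₁ ends₂) l h (pendPtL (E₂ := E₂) pt₁) := by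
  have hmem : ∀ b (ε : ι b ⊕ E₂ → Bool), h ∉ hull (Glue.glue ends₁ ends₂) (pendPtL pt₁ b ε) l := by
    intro b ε
    rw [hull_glue_l_iff hg hh hhl]
    exact (hc.block b).mem _
  have hPh : ∀ b (ε : ι b ⊕ E₂ → Bool), hullPair (Glue.glue ends₁ ends₂) (pendPtL pt₁ b ε) h =
      hullPair ends₁ (pt₁ b (ε ∘ Sum.inl)) h := fun b ε => hullPair_glue_h hg hh (hmem b ε)
  have hPl : ∀ b (ε : ι b ⊕ E₂ → Bool), hullPair (Glue.glue ends₁ ends₂) (pendPtL pt₁ b ε) l =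
      ((hullPair ends₁ (pt₁ b (ε ∘ Sum.inl)) l).1 ∪ (hullPair ends₂ (ε ∘ Sum.inr) l).1,
        (hullPair ends₁ (pt₁ b (ε ∘ Sum.inl)) l).2 ∪ (hullPair ends₂ (ε ∘ Sum.inr) l).2) :=
    fun b ε => hullPair_glue_l hg _
  refine ⟨fun b => ⟨?_, hmem b, ?_, ?_, ?_⟩, ?_, ?_⟩
  · intro ε ε' heq
    have e1 := congrArg (fun ζ => ζ ∘ Sum.inl) heq
    have e2 := congrArg (fun ζ => ζ ∘ Sum.inr) heq
    simp only [pendPtL, pair_inl, pair_inr] at e1 e2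
    have f1 := (hc.block b).inj e1
    funext j
    cases j with
    | inl j => exact congrFun f1 j
    | inr j => exact congrFun e2 j
  · intro ε ε' hle
    rw [hPl, hPl]
    have h1 := (hc.block b).l_mono (show ε ∘ Sum.inl ≤ ε' ∘ Sum.inl from fun j => hle (Sum.inl j))
    have h2 := hullPair_mono (ends := ends₂) (show ε ∘ Sum.inr ≤ ε' ∘ Sum.inr from
      fun j => hle (Sum.inr j)) l
    exact ⟨Set.union_subset_union h1.1 h2.1, Set.union_subset_union h1.2 h2.2⟩
  · intro ε ε' hle
    rw [hPh, hPh]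
    exact (hc.block b).h_anti (fun j => hle (Sum.inl j))
  · rcases (hc.block b).mirror with hm | hm
    · left
      intro ε
      rw [hPl, hPl, cubeNot_comp_inl', cubeNot_comp_inr', hm, hullPair_blue]
      rfl
    · right
      intro ε
      rw [hPh, hPh, cubeNot_comp_inl', hm]
  · intro ζ hζ
    rw [hull_glue_l_iff hg hh hhl] at hζ
    obtain ⟨b, ε₁, he₁⟩ := hc.cover _ hζ
    refine ⟨b, Sum.elim ε₁ (ζ ∘ Sum.inr), ?_⟩
    simp only [pendPtL]
    have e1 : (Sum.elim ε₁ (ζ ∘ Sum.inr) ∘ Sum.inl : ι b → Bool) = ε₁ := rfl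
    have e2 : (Sum.elim ε₁ (ζ ∘ Sum.inr) ∘ Sum.inr : Config E₂) = ζ ∘ Sum.inr := rfl
    rw [e1, e2, he₁, pair_comp]
  · intro b b' ε ε' heq
    have e1 := congrArg (fun ζ => ζ ∘ Sum.inl) heq
    simp only [pendPtL, pair_inl] at e1
    exact hc.disj _ _ _ _ e1

/-- **Cube covers survive a graph glued at `h`.** -/
theorem cubeCover_glue_h (hg : IsGluing ends₁ ends₂ h V₁ V₂) (hl : l ∈ V₁) (hlh : l ≠ h)
    (hc : CubeCover ends₁ l h pt₁) :
    CubeCover (Glue.glue ends₁ ends₂) l h (pendPtH (E₂ := E₂) pt₁) := by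
  have hmem : ∀ b (ε : ι b ⊕ E₂ → Bool), h ∉ hull (Glue.glue ends₁ ends₂) (pendPtH pt₁ b ε) l := by
    intro b ε
    rw [notMem_hull_comm, hull_glue_l_iff hg hl hlh, ← notMem_hull_comm]
    exact (hc.block b).mem _
  have hPl : ∀ b (ε : ι b ⊕ E₂ → Bool), hullPair (Glue.glue ends₁ ends₂) (pendPtH pt₁ b ε) l =
      hullPair ends₁ (pt₁ b (ε ∘ Sum.inl)) l := by
    intro b ε
    have := hmem b ε
    rw [notMem_hull_comm] at this
    exact hullPair_glue_h hg hl this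
  have hPh : ∀ b (ε : ι b ⊕ E₂ → Bool), hullPair (Glue.glue ends₁ ends₂) (pendPtH pt₁ b ε) h =
      ((hullPair ends₁ (pt₁ b (ε ∘ Sum.inl)) h).1 ∪ (hullPair ends₂ (blue (ε ∘ Sum.inr)) h).1,
        (hullPair ends₁ (pt₁ b (ε ∘ Sum.inl)) h).2 ∪ (hullPair ends₂ (blue (ε ∘ Sum.inr)) h).2) :=
    fun b ε => hullPair_glue_l hg _
  refine ⟨fun b => ⟨?_, hmem b, ?_, ?_, ?_⟩, ?_, ?_⟩
  · intro ε ε' heq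
    have e1 := congrArg (fun ζ => ζ ∘ Sum.inl) heq
    have e2 := congrArg (fun ζ => ζ ∘ Sum.inr) heq
    simp only [pendPtH, pair_inl, pair_inr] at e1 e2
    have f1 := (hc.block b).inj e1
    have f2 : ε ∘ Sum.inr = ε' ∘ Sum.inr := by
      have := congrArg blue e2
      rwa [blue_blue, blue_blue] at this
    funext j
    cases j with
    | inl j => exact congrFun f1 j
    | inr j => exact congrFun f2 j
  · intro ε ε' hle
    rw [hPl, hPl]
    exact (hc.block b).l_mono (fun j => hle (Sum.inl j))
  · intro ε ε' hle
    rw [hPh, hPh]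
    have h1 := (hc.block b).h_anti (show ε ∘ Sum.inl ≤ ε' ∘ Sum.inl from fun j => hle (Sum.inl j))
    have h2 : blue (ε' ∘ Sum.inr) ≤ blue (ε ∘ Sum.inr) := by
      intro j
      have := hle (Sum.inr j)
      simp only [blue, Function.comp]
      revert this
      cases ε (Sum.inr j) <;> cases ε' (Sum.inr j) <;> simp
    have h3 := hullPair_mono (ends := ends₂) h2 h
    exact ⟨Set.union_subset_union h1.1 h3.1, Set.union_subset_union h1.2 h3.2⟩
  · rcases (hc.block b).mirror with hm | hm
    · left
      intro ε
      rw [hPl, hPl, cubeNot_comp_inl', hm]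
    · right
      intro ε
      rw [hPh, hPh, cubeNot_comp_inl', cubeNot_comp_inr', blue_blue, hm, hullPair_blue]
      rfl
  · intro ζ hζ
    rw [notMem_hull_comm, hull_glue_l_iff hg hl hlh, ← notMem_hull_comm] at hζ
    obtain ⟨b, ε₁, he₁⟩ := hc.cover _ hζ
    refine ⟨b, Sum.elim ε₁ (blue (ζ ∘ Sum.inr)), ?_⟩
    simp only [pendPtH]
    have e1 : (Sum.elim ε₁ (blue (ζ ∘ Sum.inr)) ∘ Sum.inl : ι b → Bool) = ε₁ := rfl
    have e2 : (Sum.elim ε₁ (blue (ζ ∘ Sum.inr)) ∘ Sum.inr : Config E₂) = blue (ζ ∘ Sum.inr) :=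
      rfl
    rw [e1, e2, he₁, blue_blue, pair_comp]
  · intro b b' ε ε' heq
    have e1 := congrArg (fun ζ => ζ ∘ Sum.inl) heq
    simp only [pendPtH, pair_inl] at e1
    exact hc.disj _ _ _ _ e1

end Blocks

end Summit.Ventures.PercRepro2
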